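import Summits.CriticalPhenomena.PercolationContinuityZ3.Theorems.PercNearOneGluingNoHeavyLowerTailSunflowerSixBudgetW
import Summits.CriticalPhenomena.PercolationContinuityZ3.Theorems.PercNearOneGluingNoHeavyLowerTailSunflowerKDecreasing
import HarnessLib

/-!
# `NoHeavyLowerTail` (crux stmt-CriticalPhenomena-4575), abstract sunflower cubic: the UNIVERSAL WEAK BOUND
# `∏ G_j ≤ (g*)^(n−1)` — (RES0′) up to the factor `a`, for EVERY family and every `n`, by the pendant lemma on the
# `w`-averaged square

Support file (seat `prim-ineq-prove-1` gen 61; `--supports stmt-CriticalPhenomena-4575`).  No `sorry`, no named facts.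
Memo: run/shared/lean/prim/prim-ineq-prove-1/FINDING-CPL-prove1-g61.md §1.  Companion: `…SunflowerCappedPendant` (the sharp
statement as a capped pendant lemma).

THE OBSERVATION.  In the two-linked-systems model of (RES0′) (`…SunflowerLinkedCurrency`, `…SunflowerWSplit`: coins `τ, σ, s`,
floors `α₀₀ ≤ α₀₁ ≤ α₁₁`, petals `(y,k,g,h)` with links `g ≤ k`, `g ≤ h`, faces `Ȳ = (1−s)y + sk`, `H = (1−σ)g + σh`,
`G = τσ + (1−τ)(1−s)α₀₀ + τ(1−σ)Ȳ + s(1−τ)H`) the petal value is, LETTER FOR LETTER, the factor of the pendant analytic lemma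
`Pendant.pendant_prod_le` (gen 49) on the `w`-AVERAGED square `(z₁,u)`:
`G = στ·1 + σ(1−τ)·h̃ + (1−σ)τ·Ȳ + (1−σ)(1−τ)·g̃`, `h̃ := sh + (1−s)α₀₀`, `g̃ := sg + (1−s)α₀₀`,
with `(s,t,b,β,u,vv,m) := (σ, τ, b_Ȳ, β̃ := sα₁₁ + (1−s)α₀₀, Ȳ, h̃, g̃)`: the floors are `b_Ȳ` (for `Ȳ` and `g̃`) and `β̃`, the link
`m ≤ u` is `g̃ ≤ Ȳ ⟸ g ≤ k ∧ α₀₀ ≤ y`, `(1−σ)g̃ + σh̃ = sH + (1−s)α₀₀` is the `w`-average `H̃` of the `H`-face (floor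
`(1−σ)b_Ȳ + σβ̃ = s b_H + (1−s)α₀₀`), and the pendant constant `στ + σ(1−τ)β̃ + (1−σ)b_Ȳ` is `g*`.  The budgets on `h̃`, `H̃` follow
from `(Bh)`, `(BH)` by one coin (`prod_wavg_le`): `∏ h̃_j ≤ β̃^(n−1)·V`, `∏ H̃_j ≤ b_H̃^(n−1)·V` with the cap `V := s + (1−s)α₀₀ ≤ 1`.
Dropping the caps, the pendant lemma gives `res0_weak_universal`: `∏ G_j ≤ (g*)^(n−1)` for EVERY family and every `n`, from
`(BȲ) + (Bh) + (BH)` and the links `g ≤ k`, `α₀₀ ≤ y` alone (no `(By)`, `(Bk)`, no caps, no `g ≤ h`) — the sharp (RES0′) has the extra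
factor `a = G(full) = τ + (1−τ)V < 1` on the right; keeping the caps is the companion file's `CappedPendant`.
-/

noncomputable section

namespace Summit.CriticalPhenomena.PercolationContinuityZ3.Theorems.SunflowerPartition

namespace SafeCalc

namespace LinkedCurrency

open Finset

variable {κ : Type*}

/-- **One coin through the `w`-average.**  If `f ≤ x_j` on a nonempty `S` with `0 < f` and `∏_S x_j ≤ f^(|S|−1)`, then for
`s ∈ [0,1]`, `e ≥ 0`: `∏_S (s x_j + (1−s)e) ≤ (s f + (1−s)e)^(|S|−1) · (s + (1−s)e)` — the budget of the `w`-averaged cell,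
with the cap `s + (1−s)e` of its full value (`KDecreasing.prod_affine_le` with `z_j = x_j/f`, `∏ z_j ≤ 1/f`). [this work] -/
theorem prod_wavg_le {s e f : ℝ} (hs0 : 0 ≤ s) (hs1 : s ≤ 1) (he : 0 ≤ e) (hf : 0 < f) (S : Finset κ) (hS : S.Nonempty)
    (x : κ → ℝ) (hx : ∀ j ∈ S, f ≤ x j) (hB : ∏ j ∈ S, x j ≤ f ^ (S.card - 1)) :
    ∏ j ∈ S, (s * x j + (1 - s) * e) ≤ (s * f + (1 - s) * e) ^ (S.card - 1) * (s + (1 - s) * e) := by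
  classical
  have hs' : 0 ≤ 1 - s := sub_nonneg.2 hs1
  have hz : ∀ j ∈ S, 1 ≤ x j / f := fun j hj => by rw [le_div_iff₀ hf, one_mul]; exact hx j hj
  have h1 := KDecreasing.prod_affine_le S (α := (1 - s) * e) (β := s * f) (mul_nonneg hs' he) (mul_nonneg hs0 hf.le)
    (fun j => x j / f) hz hS
  have h2 : ∀ j, (1 - s) * e + s * f * (x j / f) = s * x j + (1 - s) * e := fun j => by
    field_simp
    ring
  have hcard : S.card = S.card - 1 + 1 := (Nat.sub_add_cancel (Finset.card_pos.2 hS)).symm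
  have h3 : f * ∏ j ∈ S, (x j / f) ≤ 1 := by
    rw [Finset.prod_div_distrib, Finset.prod_const]
    have hfS : 0 < f ^ S.card := pow_pos hf _
    rw [mul_div_assoc', div_le_one hfS]
    calc f * ∏ j ∈ S, x j ≤ f * f ^ (S.card - 1) := mul_le_mul_of_nonneg_left hB hf.le
      _ = f ^ S.card := by conv_rhs => rw [hcard, pow_succ']
  have h4 : (1 - s) * e + s * f * ∏ j ∈ S, (x j / f) ≤ s + (1 - s) * e := by
    have := mul_le_mul_of_nonneg_left h3 hs0
    nlinarith
  calc ∏ j ∈ S, (s * x j + (1 - s) * e) = ∏ j ∈ S, ((1 - s) * e + s * f * (x j / f)) :=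
        prod_congr rfl (fun j _ => (h2 j).symm)
    _ ≤ ((1 - s) * e + s * f * ∏ j ∈ S, (x j / f)) * ((1 - s) * e + s * f) ^ (S.card - 1) := h1
    _ ≤ (s + (1 - s) * e) * ((1 - s) * e + s * f) ^ (S.card - 1) :=
        mul_le_mul_of_nonneg_right h4 (pow_nonneg (add_nonneg (mul_nonneg hs' he) (mul_nonneg hs0 hf.le)) _)
    _ = (s * f + (1 - s) * e) ^ (S.card - 1) * (s + (1 - s) * e) := by ring

/-- **(RES0′) UP TO THE FACTOR `a`, FOR EVERY FAMILY AND EVERY `n`.**  Coins `τ, σ, s ∈ [0,1]`, floors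
`0 < α₀₀ ≤ α₀₁ ≤ α₁₁ ≤ 1`; petals `j ∈ S` (nonempty) with `α₀₀ ≤ y_j`, `α₀₁ ≤ k_j`, `α₀₁ ≤ g_j ≤ k_j`, `α₁₁ ≤ h_j`
(no caps, no `g ≤ h`, no `y ≤ k`); budgets `(BȲ) ∏((1−s)y_j + sk_j) ≤ b_Ȳ^(|S|−1)`, `(Bh) ∏ h_j ≤ α₁₁^(|S|−1)`,
`(BH) ∏((1−σ)g_j + σh_j) ≤ b_H^(|S|−1)`.  Then with `G_j = τσ + (1−τ)(1−s)α₀₀ + τ(1−σ)Ȳ_j + s(1−τ)H_j` and `g* = G(floor)`: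
`∏_S G_j ≤ (g*)^(|S|−1)`.  (The sharp (RES0′) has the extra factor `a = G(full) < 1` on the right.)  Proof: the pendant
analytic lemma on the `w`-averaged square, `(s,t,b,β,u,vv,m) := (σ,τ,b_Ȳ,sα₁₁+(1−s)α₀₀,Ȳ,sh+(1−s)α₀₀,sg+(1−s)α₀₀)`, the
budgets on `vv`, `(1−s)m + s vv` being `(Bh)`, `(BH)` passed through `prod_wavg_le` (and the caps `≤ 1` dropped). [this work] -/
theorem res0_weak_universal [DecidableEq κ] {τ σ s α00 α01 α11 : ℝ} (hτ0 : 0 ≤ τ) (hτ1 : τ ≤ 1) (hσ0 : 0 ≤ σ)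
    (hσ1 : σ ≤ 1) (hs0 : 0 ≤ s) (hs1 : s ≤ 1) (hα0 : 0 < α00) (h01 : α00 ≤ α01) (h11 : α01 ≤ α11) (hα1 : α11 ≤ 1)
    (S : Finset κ) (hS : S.Nonempty) (y k gc h : κ → ℝ)
    (hy : ∀ j ∈ S, α00 ≤ y j) (hk : ∀ j ∈ S, α01 ≤ k j) (hg : ∀ j ∈ S, α01 ≤ gc j) (hgk : ∀ j ∈ S, gc j ≤ k j)
    (hh : ∀ j ∈ S, α11 ≤ h j)
    (hBY : ∏ j ∈ S, ((1 - s) * y j + s * k j) ≤ ((1 - s) * α00 + s * α01) ^ (S.card - 1))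
    (hBh : ∏ j ∈ S, h j ≤ α11 ^ (S.card - 1))
    (hBH : ∏ j ∈ S, ((1 - σ) * gc j + σ * h j) ≤ ((1 - σ) * α01 + σ * α11) ^ (S.card - 1)) :
    ∏ j ∈ S, (τ * σ + (1 - τ) * (1 - s) * α00 + τ * (1 - σ) * ((1 - s) * y j + s * k j) +
        s * (1 - τ) * ((1 - σ) * gc j + σ * h j)) ≤
      (τ * σ + (1 - τ) * (1 - s) * α00 + τ * (1 - σ) * ((1 - s) * α00 + s * α01) +
        s * (1 - τ) * ((1 - σ) * α01 + σ * α11)) ^ (S.card - 1) := by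
  classical
  have hs' : 0 ≤ 1 - s := sub_nonneg.2 hs1
  have hσ' : 0 ≤ 1 - σ := sub_nonneg.2 hσ1
  have hα01 : 0 < α01 := hα0.trans_le h01
  have hα11 : 0 < α11 := hα01.trans_le h11
  -- the w-averaged coordinates
  set e := S.equivFin with he
  have mem : ∀ i : Fin S.card, ((e.symm i : S) : κ) ∈ S := fun i => (e.symm i).2
  set u : Fin S.card → ℝ := fun i => (1 - s) * y ((e.symm i : S) : κ) + s * k ((e.symm i : S) : κ) with hu
  set vv : Fin S.card → ℝ := fun i => s * h ((e.symm i : S) : κ) + (1 - s) * α00 with hvv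
  set m : Fin S.card → ℝ := fun i => s * gc ((e.symm i : S) : κ) + (1 - s) * α00 with hm
  set b : ℝ := (1 - s) * α00 + s * α01 with hb
  set β : ℝ := s * α11 + (1 - s) * α00 with hβ
  have hbpos : 0 < b := by rw [hb]; nlinarith
  have hbβ : b ≤ β := by rw [hb, hβ]; nlinarith
  have hbH : 0 < (1 - σ) * α01 + σ * α11 := by nlinarith
  -- budgets on vv and on (1-σ) m + σ vv
  have hBvv : ∏ i, vv i ≤ β ^ (S.card - 1) := by
    have h1 := prod_wavg_le hs0 hs1 hα0.le hα11 S hS h hh hBh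
    have h2 : ∏ i, vv i = ∏ j ∈ S, (s * h j + (1 - s) * α00) := by
      rw [hvv, ← prod_eq_prod_fin_equiv S (fun j => s * h j + (1 - s) * α00)]
    rw [h2, hβ]
    refine h1.trans ?_
    have hV1 : s + (1 - s) * α00 ≤ 1 := by nlinarith
    have hpow : 0 ≤ (s * α11 + (1 - s) * α00) ^ (S.card - 1) := pow_nonneg (by positivity) _
    calc (s * α11 + (1 - s) * α00) ^ (S.card - 1) * (s + (1 - s) * α00)
        ≤ (s * α11 + (1 - s) * α00) ^ (S.card - 1) * 1 := mul_le_mul_of_nonneg_left hV1 hpow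
      _ = (s * α11 + (1 - s) * α00) ^ (S.card - 1) := mul_one _
  have hBg : ∏ i, ((1 - σ) * m i + σ * vv i) ≤ ((1 - σ) * b + σ * β) ^ (S.card - 1) := by
    have h1 := prod_wavg_le hs0 hs1 hα0.le hbH S hS (fun j => (1 - σ) * gc j + σ * h j)
      (fun j hj => by nlinarith [hg j hj, hh j hj]) hBH
    have h2 : ∏ i, ((1 - σ) * m i + σ * vv i) = ∏ j ∈ S, (s * ((1 - σ) * gc j + σ * h j) + (1 - s) * α00) := by
      rw [hm, hvv, prod_eq_prod_fin_equiv S (fun j => s * ((1 - σ) * gc j + σ * h j) + (1 - s) * α00)]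
      exact Fintype.prod_congr _ _ (fun i => by ring)
    rw [h2]
    refine h1.trans ?_
    have hV1 : s + (1 - s) * α00 ≤ 1 := by nlinarith
    have h3 : s * ((1 - σ) * α01 + σ * α11) + (1 - s) * α00 = (1 - σ) * b + σ * β := by rw [hb, hβ]; ring
    rw [h3]
    have hpow : 0 ≤ ((1 - σ) * b + σ * β) ^ (S.card - 1) := pow_nonneg (by nlinarith) _
    calc ((1 - σ) * b + σ * β) ^ (S.card - 1) * (s + (1 - s) * α00)
        ≤ ((1 - σ) * b + σ * β) ^ (S.card - 1) * 1 := mul_le_mul_of_nonneg_left hV1 hpow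
      _ = ((1 - σ) * b + σ * β) ^ (S.card - 1) := mul_one _
  have hBu : ∏ i, u i ≤ b ^ (S.card - 1) := by
    rw [hu, hb, ← prod_eq_prod_fin_equiv S (fun j => (1 - s) * y j + s * k j)]; exact hBY
  have key := Pendant.pendant_prod_le (n := S.card) (b := b) (β := β) (s := σ) (t := τ) hbpos hbβ hσ0 hσ1 hτ0 hτ1
    u vv m
    (fun i => by show b ≤ u i; rw [hb, hu]; nlinarith [hy _ (mem i), hk _ (mem i)])
    (fun i => by show β ≤ vv i; rw [hβ, hvv]; nlinarith [hh _ (mem i)])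
    (fun i => by show b ≤ m i; rw [hb, hm]; nlinarith [hg _ (mem i)])
    (fun i => by show m i ≤ u i; rw [hm, hu]; nlinarith [hgk _ (mem i), hy _ (mem i)])
    hBu hBvv hBg
  have e1 : ∏ j ∈ S, (τ * σ + (1 - τ) * (1 - s) * α00 + τ * (1 - σ) * ((1 - s) * y j + s * k j) +
        s * (1 - τ) * ((1 - σ) * gc j + σ * h j)) =
      ∏ i : Fin S.card, (σ * τ + σ * (1 - τ) * vv i + (1 - σ) * τ * u i + (1 - σ) * (1 - τ) * m i) := by
    rw [prod_eq_prod_fin_equiv S]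
    refine Fintype.prod_congr _ _ (fun i => ?_)
    rw [hu, hvv, hm]; ring
  rw [e1]
  refine key.trans (le_of_eq ?_)
  rw [hb, hβ]; ring

end LinkedCurrency

end SafeCalc

end Summit.CriticalPhenomena.PercolationContinuityZ3.Theorems.SunflowerPartition
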